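import Literature.IUT.LogThetaLattice.GlobalLGPFrobenioidsModFrakRealifiedDivisors
import Literature.AnabelianGeometry.EtaleTheta.RealificationUniversal
import Literature.AlgebraicGeometry.Frobenioids.RealPowNNRealLinear
import HarnessLib

/-!
# [FrdI] Prop. 5.3 / Thm. 6.4 (i) at the model of [IUTchIII] Prop. 3.7 (ii): THE canonical realification
# `Φ(∗)^rlf` of the integral divisor monoid of `(†𝓕⊛_𝔪𝔬𝔡)_α` IS the real divisor monoid `Φ^ℝ(∗) = ⊕'_v ℝ_{≥0}` of
# `(†𝓕⊛ℝ_𝔪𝔬𝔡)_α` (abc-iut cell, layer L6; sub-row «J1-rlf-bridge», piece (3b); written by abc-iut-w4-d015)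

S. Mochizuki, *The geometry of Frobenioids I*, Def. 2.4 (i) p. 48 (the realification `M^rlf`), Prop. 5.3 p. 103
("the realification `C^rlf` … the model Frobenioid associated to the divisor monoid `Φ^rlf`") and Thm. 6.4 (i)
p. 115 ("`(Φ^rlf)^gp(L) = ArithDiv_ℝ(L)`") [cite: MochizukiFrdI2008, Thm. 6.4 (i) p.115]; S. Mochizuki, *The étale
theta function …*, Lemma 3.5 (i) p. 75 (the universal property of `M^pf → M^rlf` among monoids supported by `ℝ`, tree:
abc-iut-L2-d2 `RlfUniversal.existsUnique_lift`) [cite: MochizukiEtTh2009, Lem 3.5 p.75]; S. Mochizuki,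
*Inter-universal Teichmüller theory III*, Prop. 3.7 (ii) p. 110 l. 48–49 [claim: Mochizuki2012, status: disputed].

WHAT. `M := Φ(∗) = EffDiv (Places F) (Gamma F) (nonneg F)` (perf-factorial: `Prop37.isPerfFactorial_effDiv`),
`Q := Φ^ℝ(∗) = EffDiv (ModelPlaces F) (fun _ ↦ ℝ) nonnegModel` (supported by `ℝ`: `Prop37.supports_R_effDivReal`),
`realifyEffMul : M →* Q` (abc-iut-w4-d005's realification on objects). Then:
* `Prop37.realifyPf : M^pf →* Q` — the unique extension of `realifyEffMul` to the perfection (`Q` is perfect);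
* **`Prop37.rlfToModel : Φ(∗)^rlf →* Φ^ℝ(∗)`** — THE homomorphism with `rlfToModel ∘ (M^pf → M^rlf) = realifyPf`
  (`RlfUniversal.existsUnique_lift`), unique (`rlfToModel_unique`), and `rlfToModel (ι D) = realifyEffMul D`;
* `rlfToModel_rpow` — it is `ℝ_{≥0}`-equivariant (coordinatewise `IsPerfFactorial.Rlf.hom_nnreal_rpow`);
* `rlfToModel_surjective` (every `⊕'_v r_v` is `∏_v rlfToModel (ι(e_v)^{r_v})`);
* `rlfToModel_injective` (`RlfUniversal.lift_injective`: `realifyPf` is injective with group-saturated image = the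
  families with RATIONAL finite-place classes);
* **`Prop37.rlfEquivModel : (isPerfFactorial_effDiv F).Rlf ≃* EffDiv (ModelPlaces F) (fun _ ↦ ℝ) nonnegModel`** with
  `rlfEquivModel (ι D) = realifyEffMul D` — the identification asked for by the holders of [IUTchIII] Prop. 3.7's
  categorical level (abc-iut-L6-t4, abc-iut-w5-d153: residual J1).

Nothing here asserts a disputed claim or takes a side on [IUTchIII] Cor. 3.12; typed ≠ discharged; instantiated ≠
endorsed.
-/

noncomputable section

open scoped NNReal

namespace Literature.IUT.LogThetaLattice

namespace Prop37

open NumberField GlobalFrobenioidModels Literature.AlgebraicGeometry.Frobenioids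
  Literature.AnabelianGeometry.EtaleTheta

variable (F : Type) [Field F] [NumberField F]

/-! ### Notation-free abbreviations for the two divisor monoids -/

/-- `Φ(∗)`: the integral divisor monoid of `(†𝓕⊛_𝔪𝔬𝔡)_α`. [cite: MochizukiFrdI2008, Ex. 6.3 p.113] -/
abbrev MInt : Type := EffDiv (Places F) (Gamma F) (nonneg F)

/-- `Φ^ℝ(∗)`: the real divisor monoid of `(†𝓕⊛ℝ_𝔪𝔬𝔡)_α`. [cite: MochizukiFrdI2008, Thm. 6.4 (i) p.115] -/
abbrev MReal : Type := EffDiv (ModelPlaces F) (fun _ => ℝ) nonnegModel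

/-- The natural map `ι : Φ(∗) → Φ(∗)^rlf` (`M → M^pf → M^rlf`). [cite: MochizukiFrdI2008, Def. 2.4(i) p.48] -/
def iotaRlf : MInt F →* (isPerfFactorial_effDiv F).Rlf :=
  (isPerfFactorial_effDiv F).toRealification.comp (Literature.AlgebraicGeometry.Frobenioids.Perfection.of (MInt F))

/-- `iotaRlf` unfolded. [cite: MochizukiFrdI2008, Def. 2.4(i) p.48] -/
theorem iotaRlf_apply (D : MInt F) :
    iotaRlf F D = (isPerfFactorial_effDiv F).toRealification (Literature.AlgebraicGeometry.Frobenioids.Perfection.of (MInt F) D) := rfl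

/-! ### The extension of the realification to the perfection `M^pf → Φ^ℝ(∗)` -/

/-- **`realifyPf : Φ(∗)^pf → Φ^ℝ(∗)`**, the unique extension of `realifyEffMul` to the perfection (`Φ^ℝ(∗)` being
perfect: `Q ≅ Q^pf`). [cite: MochizukiFrdI2008, §0 p.11] -/
def realifyPf : Literature.AlgebraicGeometry.Frobenioids.Perfection (MInt F) →* MReal F :=
  (isPerfect_effDivReal F).equivPerfection.symm.toMonoidHom.comp (Literature.AlgebraicGeometry.Frobenioids.Perfection.map (realifyEffMul F))

/-- `realifyPf ∘ of = realifyEffMul`. [cite: MochizukiFrdI2008, §0 p.11] -/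
theorem realifyPf_of (D : MInt F) : realifyPf F (Literature.AlgebraicGeometry.Frobenioids.Perfection.of (MInt F) D) = realifyEffMul F D := by
  show (isPerfect_effDivReal F).equivPerfection.symm (Literature.AlgebraicGeometry.Frobenioids.Perfection.map (realifyEffMul F) (Literature.AlgebraicGeometry.Frobenioids.Perfection.of (MInt F) D)) = _
  apply (isPerfect_effDivReal F).equivPerfection.injective
  rw [MulEquiv.apply_symm_apply, IsPerfect.equivPerfection_apply]
  exact DFunLike.congr_fun (Literature.AlgebraicGeometry.Frobenioids.Perfection.map_comp_of (realifyEffMul F)) D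

/-- `realifyPf ∘ of = realifyEffMul` as homomorphisms. [cite: MochizukiFrdI2008, §0 p.11] -/
theorem realifyPf_comp_of : (realifyPf F).comp (Literature.AlgebraicGeometry.Frobenioids.Perfection.of (MInt F)) = realifyEffMul F :=
  MonoidHom.ext (realifyPf_of F)

/-- `realifyPf` on a formal root `a^{1/n}`: its `n`-th power is `realifyEffMul a`. [cite: MochizukiFrdI2008, §0 p.11] -/
theorem realifyPf_mk_pow (D : MInt F) (n : ℕ+) :
    realifyPf F (Literature.AlgebraicGeometry.Frobenioids.Perfection.mk D n) ^ (n : ℕ) = realifyEffMul F D := by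
  rw [← map_pow, Literature.AlgebraicGeometry.Frobenioids.Perfection.mk_pow_self, realifyPf_of]

/-- `realifyPf` is injective (`realifyEffMul` is, and `Perfection.map` preserves injectivity).
[cite: MochizukiFrdI2008, §0 p.11] -/
theorem realifyPf_injective : Function.Injective (realifyPf F) :=
  (isPerfect_effDivReal F).equivPerfection.symm.injective.comp
    (Literature.AlgebraicGeometry.Frobenioids.Perfection.map_injective (realifyEffMul F) (realifyEffMul_injective F))

/-! ### THE homomorphism `Φ(∗)^rlf → Φ^ℝ(∗)` (universal property of `M^pf → M^rlf`) -/

/-- **`rlfToModel : Φ(∗)^rlf → Φ^ℝ(∗)`** — THE homomorphism extending the realification through `M^pf → M^rlf`,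
given by the universal property of the realification among monoids supported by `ℝ` (abc-iut-L2-d2
`RlfUniversal.existsUnique_lift`, [EtTh] Lem. 3.5 (i)); its target `Φ^ℝ(∗)` is supported by `ℝ`
(`supports_R_effDivReal`). [cite: MochizukiEtTh2009, Lem 3.5 p.75] -/
def rlfToModel : (isPerfFactorial_effDiv F).Rlf →* MReal F :=
  (RlfUniversal.existsUnique_lift (isPerfFactorial_effDiv F) (supports_R_effDivReal F) (realifyPf F)).exists.choose

/-- Defining property: `rlfToModel ∘ (M^pf → M^rlf) = realifyPf`. [cite: MochizukiEtTh2009, Lem 3.5 p.75] -/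
theorem rlfToModel_comp_toRealification :
    (rlfToModel F).comp (isPerfFactorial_effDiv F).toRealification = realifyPf F :=
  (RlfUniversal.existsUnique_lift (isPerfFactorial_effDiv F) (supports_R_effDivReal F) (realifyPf F)).exists.choose_spec

/-- **Uniqueness**: any homomorphism `Φ(∗)^rlf → Φ^ℝ(∗)` over `realifyPf` is `rlfToModel`.
[cite: MochizukiEtTh2009, Lem 3.5 p.75] -/
theorem rlfToModel_unique (φ : (isPerfFactorial_effDiv F).Rlf →* MReal F)
    (hφ : φ.comp (isPerfFactorial_effDiv F).toRealification = realifyPf F) : φ = rlfToModel F :=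
  (RlfUniversal.existsUnique_lift (isPerfFactorial_effDiv F) (supports_R_effDivReal F) (realifyPf F)).unique hφ
    (rlfToModel_comp_toRealification F)

/-- `rlfToModel` on the image of `M^pf`. [cite: MochizukiEtTh2009, Lem 3.5 p.75] -/
theorem rlfToModel_toRealification (x : Literature.AlgebraicGeometry.Frobenioids.Perfection (MInt F)) :
    rlfToModel F ((isPerfFactorial_effDiv F).toRealification x) = realifyPf F x :=
  DFunLike.congr_fun (rlfToModel_comp_toRealification F) x

/-- **`rlfToModel (ι D) = realifyEffMul D`**: on `Φ(∗)` the homomorphism IS abc-iut-w4-d005's realification on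
objects. [cite: MochizukiFrdI2008, Prop. 5.3 p.103] -/
theorem rlfToModel_iotaRlf (D : MInt F) : rlfToModel F (iotaRlf F D) = realifyEffMul F D := by
  rw [iotaRlf_apply, rlfToModel_toRealification, realifyPf_of]

/-! ### Coordinates of `Φ^ℝ(∗)` and `ℝ_{≥0}`-equivariance of `rlfToModel` -/

/-- The `p`-th coordinate `Φ^ℝ(∗) → ℝ_{≥0}` (a homomorphism). [cite: MochizukiFrdI2008, Thm. 6.4 (i) p.115] -/
def coord (p : ModelPlaces F) : MReal F →* Multiplicative ℝ≥0 :=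
  ((Pi.evalMonoidHom (fun _ : ModelPlaces F => Multiplicative ℝ≥0) p).comp
    (directSum fun _ : ModelPlaces F => Multiplicative ℝ≥0).subtype).comp
    (effDivRealMulEquivDirectSum F).toMonoidHom

omit [NumberField F] in
/-- `coord p x` read in `ℝ` is the class of `x` at `p`. [cite: MochizukiFrdI2008, Thm. 6.4 (i) p.115] -/
@[simp] theorem coe_toAdd_coord (p : ModelPlaces F) (x : MReal F) :
    ((Multiplicative.toAdd (coord F p x) : ℝ≥0) : ℝ) = (x.toAdd : FrakObj (ModelPlaces F) (fun _ => ℝ)).cls p := rfl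

omit [NumberField F] in
/-- Elements of `Φ^ℝ(∗)` are determined by their coordinates. [cite: MochizukiFrdI2008, Thm. 6.4 (i) p.115] -/
theorem ext_coord {x y : MReal F} (h : ∀ p, coord F p x = coord F p y) : x = y := by
  apply Multiplicative.toAdd.injective
  refine Subtype.ext (FrakObj.ext_cls (funext fun p => ?_))
  rw [← coe_toAdd_coord, ← coe_toAdd_coord, h p]

/-- **`rlfToModel` is `ℝ_{≥0}`-equivariant**: `rlfToModel (a^r)` has coordinates `r · (coordinates of rlfToModel a)`
(every homomorphism `M^rlf → ℝ_{≥0}` is `ℝ_{≥0}`-linear, `IsPerfFactorial.Rlf.hom_nnreal_rpow`, applied to the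
coordinates). [cite: MochizukiFrdI2008, Def. 2.4(i) p.48] -/
theorem toAdd_coord_rlfToModel_rpow (p : ModelPlaces F) (r : ℝ≥0) (a : (isPerfFactorial_effDiv F).Rlf) :
    Multiplicative.toAdd (coord F p (rlfToModel F (IsPerfFactorial.Rlf.rpow (isPerfFactorial_effDiv F) r a))) =
      r * Multiplicative.toAdd (coord F p (rlfToModel F a)) :=
  IsPerfFactorial.Rlf.hom_nnreal_rpow (isPerfFactorial_effDiv F) ((coord F p).comp (rlfToModel F)) r a

/-! ### The unit divisors `e_p` and surjectivity of `rlfToModel` -/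

open scoped Classical in
/-- The effective ARITHMETIC divisor `e_p ∈ Φ(F)` supported at the single place `p ∈ ModelPlaces F` with class `1`:
`1 · [w(v)] ∈ ℤ_{≥0}` at a finite `p = v`, `1 · [w] ∈ ℝ_{≥0}` at an archimedean `p = w`. [cite: MochizukiFrdI2008, Ex. 6.3 p.113] -/
def unitArith : ModelPlaces F → EffArithDivisor F
  | .inl v => (Finsupp.single (FinitePlace.mk v) 1, 0)
  | .inr w => (0, fun w' => if w' = w then 1 else 0)

/-- The unit INTEGRAL family `e_p ∈ Φ(∗)` at `p` (through `effDivOfArith`). [cite: MochizukiFrdI2008, Ex. 6.3 p.113] -/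
def unitInt (p : ModelPlaces F) : MInt F := Multiplicative.ofAdd (effDivOfArith F (unitArith F p))

open scoped Classical in
/-- **The realification of `e_p` is the unit real family at `p`**: coordinate `1` at `p`, `0` elsewhere.
[cite: MochizukiFrdI2008, Thm. 6.4 (i) p.115] -/
theorem toAdd_coord_realifyEffMul_unitInt (p q : ModelPlaces F) :
    ((Multiplicative.toAdd (coord F q (realifyEffMul F (unitInt F p))) : ℝ≥0) : ℝ) = if q = p then 1 else 0 := by
  rw [coe_toAdd_coord, realifyEffMul_apply, toAdd_ofAdd, unitInt, toAdd_ofAdd, coe_realifyEff, realifyObj_cls]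
  rcases q with v' | w'
  · rw [realifyCls_inl, effDivOfArith_cls_inr]
    rcases p with v | w
    · simp only [unitArith]
      by_cases h : v' = v
      · subst h; simp
      · rw [Finsupp.single_eq_of_ne (fun h' => h (by
            rw [← FinitePlace.maximalIdeal_mk v', ← FinitePlace.maximalIdeal_mk v, h']))]
        simp [h]
    · simp [unitArith]
  · rw [realifyCls_inr, effDivOfArith_cls_inl]
    rcases p with v | w
    · simp [unitArith]
    · simp only [unitArith]
      by_cases h : w' = w
      · subst h; simp
      · simp [h]

open scoped Classical in
/-- The same in `ℝ_{≥0}`. [cite: MochizukiFrdI2008, Thm. 6.4 (i) p.115] -/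
theorem toAdd_coord_realifyEffMul_unitInt' (p q : ModelPlaces F) :
    (Multiplicative.toAdd (coord F q (realifyEffMul F (unitInt F p))) : ℝ≥0) = if q = p then 1 else 0 := by
  apply NNReal.coe_injective
  rw [toAdd_coord_realifyEffMul_unitInt]
  split_ifs <;> simp

/-- **`rlfToModel` is SURJECTIVE**: the real family `⊕_p r_p [p]` is the image of `∏_p ι(e_p)^{r_p}` (powers
`a ↦ a^r` in `M^rlf`, `ℝ_{≥0}`-equivariance of `rlfToModel`). [cite: MochizukiFrdI2008, Thm. 6.4 (i) p.115] -/
theorem rlfToModel_surjective : Function.Surjective (rlfToModel F) := by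
  classical
  intro y
  let c : ModelPlaces F → ℝ≥0 := fun p => Multiplicative.toAdd (coord F p y)
  let S : Finset (ModelPlaces F) := (y.toAdd : FrakObj (ModelPlaces F) (fun _ => ℝ)).finite.toFinset
  refine ⟨∏ p ∈ S, IsPerfFactorial.Rlf.rpow (isPerfFactorial_effDiv F) (c p) (iotaRlf F (unitInt F p)), ?_⟩
  refine ext_coord F fun q => ?_
  apply Multiplicative.toAdd.injective
  rw [map_prod, map_prod, toAdd_prod]
  simp only [toAdd_coord_rlfToModel_rpow, rlfToModel_iotaRlf, toAdd_coord_realifyEffMul_unitInt', mul_ite, mul_one,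
    mul_zero, Finset.sum_ite_eq]
  split_ifs with hq
  · rfl
  · -- `q ∉ S`: the class of `y` at `q` vanishes
    apply NNReal.coe_injective
    rw [coe_toAdd_coord, NNReal.coe_zero]
    have : ¬ ((y.toAdd : FrakObj (ModelPlaces F) (fun _ => ℝ)).cls q ≠ 0) := fun h => hq (by
      rw [Set.Finite.mem_toFinset]; exact h)
    exact (not_not.mp this).symm

/-! ### The image of `M^pf` in `Φ^ℝ(∗)`: the RATIONAL families; injectivity of `rlfToModel` -/

omit [NumberField F] in
/-- Classes of a power in `Φ^ℝ(∗)`: `cls_p(x^n) = n · cls_p(x)`. [cite: MochizukiFrdI2008, Thm. 6.4 (i) p.115] -/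
theorem cls_pow (x : MReal F) (n : ℕ) (p : ModelPlaces F) :
    ((x ^ n).toAdd : FrakObj (ModelPlaces F) (fun _ => ℝ)).cls p =
      n * (x.toAdd : FrakObj (ModelPlaces F) (fun _ => ℝ)).cls p := by
  rw [toAdd_pow, AddSubmonoidClass.coe_nsmul, FrakObj.cls_nsmul, nsmul_eq_mul]

omit [NumberField F] in
/-- Classes of a product in `Φ^ℝ(∗)`. [cite: MochizukiFrdI2008, Thm. 6.4 (i) p.115] -/
theorem cls_mul (x y : MReal F) (p : ModelPlaces F) :
    ((x * y).toAdd : FrakObj (ModelPlaces F) (fun _ => ℝ)).cls p =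
      (x.toAdd : FrakObj (ModelPlaces F) (fun _ => ℝ)).cls p + (y.toAdd : FrakObj (ModelPlaces F) (fun _ => ℝ)).cls p := by
  rw [toAdd_mul, AddSubmonoid.coe_add, FrakObj.cls_add]

omit [NumberField F] in
/-- `n`-th powers are injective in `Φ^ℝ(∗)` (it is perfect). [cite: MochizukiFrdI2008, §0 p.11] -/
theorem pow_injective_real {n : ℕ} (hn : 0 < n) : Function.Injective fun x : MReal F => x ^ n :=
  ((isPerfect_effDivReal F).bijective_pow n hn).1

/-- The finite-place class of a realified integral family is a NATURAL number (the `toNat` of the nonnegative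
integer class). [cite: MochizukiFrdI2008, Ex. 6.3 p.113] -/
theorem cls_inl_realifyEffMul (D : MInt F) (v : IsDedekindDomain.HeightOneSpectrum (𝓞 F)) :
    ((realifyEffMul F D).toAdd : FrakObj (ModelPlaces F) (fun _ => ℝ)).cls (.inl v) =
      ((((D.toAdd : FrakObj (Places F) (Gamma F)).cls (.inr (FinitePlace.mk v))).toNat : ℕ) : ℝ) := by
  rw [realifyEffMul_apply, toAdd_ofAdd, coe_realifyEff, realifyObj_cls, realifyCls_inl]
  have h := Int.toNat_of_nonneg (cls_inr_nonneg F D.toAdd (FinitePlace.mk v))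
  exact_mod_cast h.symm

/-- **The image of `M^pf` consists of RATIONAL families**: `realifyPf (a^{1/n})` has finite-place classes in
`(1/n)·ℕ`. [cite: MochizukiFrdI2008, §0 p.11] -/
theorem exists_rat_of_mem_mrange {y : MReal F} (hy : y ∈ MonoidHom.mrange (realifyPf F)) :
    ∃ n : ℕ+, ∀ v : IsDedekindDomain.HeightOneSpectrum (𝓞 F), ∃ k : ℕ,
      (y.toAdd : FrakObj (ModelPlaces F) (fun _ => ℝ)).cls (.inl v) = (k : ℝ) / n := by
  obtain ⟨x, rfl⟩ := hy
  obtain ⟨⟨D, n⟩, rfl⟩ := Literature.AlgebraicGeometry.Frobenioids.Perfection.mk_surjective x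
  refine ⟨n, fun v => ⟨((D.toAdd : FrakObj (Places F) (Gamma F)).cls (.inr (FinitePlace.mk v))).toNat, ?_⟩⟩
  have h := congrArg (fun z : MReal F => (z.toAdd : FrakObj (ModelPlaces F) (fun _ => ℝ)).cls (.inl v))
    (realifyPf_mk_pow F D n)
  rw [cls_pow, cls_inl_realifyEffMul] at h
  have hn : (0 : ℝ) < (n : ℕ) := by exact_mod_cast n.pos
  rw [eq_div_iff hn.ne', mul_comm]
  exact_mod_cast h

/-- The integral family with prescribed natural finite-place classes `k` (finitely supported inside the support of
`y`) and archimedean classes `n · y_w`. [cite: MochizukiFrdI2008, Ex. 6.3 p.113] -/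
theorem exists_realifyEffMul_eq_pow (y : MReal F) (n : ℕ+)
    (hk : ∀ v : IsDedekindDomain.HeightOneSpectrum (𝓞 F), ∃ k : ℕ,
      (y.toAdd : FrakObj (ModelPlaces F) (fun _ => ℝ)).cls (.inl v) = (k : ℝ) / n) :
    ∃ D : MInt F, realifyEffMul F D = y ^ (n : ℕ) := by
  choose k hk using hk
  have hn : (0 : ℝ) < (n : ℕ) := by exact_mod_cast n.pos
  -- the ℕ-valued finite part, finitely supported
  have hfin : (Function.support fun w : FinitePlace F => k (FinitePlace.maximalIdeal w)).Finite := by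
    refine ((y.toAdd : FrakObj (ModelPlaces F) (fun _ => ℝ)).finite.preimage
      (f := fun w : FinitePlace F => (Sum.inl (FinitePlace.maximalIdeal w) : ModelPlaces F)) ?_).subset ?_
    · exact (Sum.inl_injective.comp FinitePlace.maximalIdeal_injective).injOn
    · intro w hw
      rw [Function.mem_support] at hw
      show (y.toAdd : FrakObj (ModelPlaces F) (fun _ => ℝ)).cls (.inl (FinitePlace.maximalIdeal w)) ≠ 0
      rw [hk]
      exact div_ne_zero (by exact_mod_cast hw) hn.ne'
  let N : FinitePlace F →₀ ℕ := Finsupp.ofSupportFinite _ hfin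
  let r : InfinitePlace F → ℝ≥0 := fun w =>
    ⟨(n : ℕ) * (y.toAdd : FrakObj (ModelPlaces F) (fun _ => ℝ)).cls (.inr w),
      mul_nonneg (by exact_mod_cast n.pos.le) (cls_nonneg_real F y.toAdd _)⟩
  refine ⟨Multiplicative.ofAdd (effDivOfArith F (N, r)), ?_⟩
  apply Multiplicative.toAdd.injective
  refine Subtype.ext (FrakObj.ext_cls (funext fun p => ?_))
  rw [realifyEffMul_apply, toAdd_ofAdd, toAdd_ofAdd, coe_realifyEff, realifyObj_cls]
  show realifyCls F _ p = ((y ^ (n : ℕ)).toAdd : FrakObj (ModelPlaces F) (fun _ => ℝ)).cls p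
  rw [cls_pow]
  rcases p with v | w
  · rw [realifyCls_inl, effDivOfArith_cls_inr, Finsupp.ofSupportFinite_coe, FinitePlace.maximalIdeal_mk, hk v]
    push_cast
    field_simp
  · rw [realifyCls_inr, effDivOfArith_cls_inl]
    rfl

/-- … hence such a rational family IS in the image of `M^pf` (`Φ^ℝ(∗)` has unique `n`-th roots).
[cite: MochizukiFrdI2008, §0 p.11] -/
theorem mem_mrange_of_rat {y : MReal F} (n : ℕ+)
    (hk : ∀ v : IsDedekindDomain.HeightOneSpectrum (𝓞 F), ∃ k : ℕ,
      (y.toAdd : FrakObj (ModelPlaces F) (fun _ => ℝ)).cls (.inl v) = (k : ℝ) / n) :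
    y ∈ MonoidHom.mrange (realifyPf F) := by
  obtain ⟨D, hD⟩ := exists_realifyEffMul_eq_pow F y n hk
  refine ⟨Literature.AlgebraicGeometry.Frobenioids.Perfection.mk D n, pow_injective_real F n.pos ?_⟩
  show realifyPf F (Literature.AlgebraicGeometry.Frobenioids.Perfection.mk D n) ^ (n : ℕ) = y ^ (n : ℕ)
  rw [realifyPf_mk_pow, hD]

/-- **The image of `M^pf` in `Φ^ℝ(∗)` = the rational families.** [cite: MochizukiFrdI2008, §0 p.11] -/
theorem mem_mrange_realifyPf_iff (y : MReal F) :
    y ∈ MonoidHom.mrange (realifyPf F) ↔ ∃ n : ℕ+, ∀ v : IsDedekindDomain.HeightOneSpectrum (𝓞 F), ∃ k : ℕ,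
      (y.toAdd : FrakObj (ModelPlaces F) (fun _ => ℝ)).cls (.inl v) = (k : ℝ) / n :=
  ⟨exists_rat_of_mem_mrange F, fun ⟨n, hk⟩ => mem_mrange_of_rat F n hk⟩

/-- **The image of `M^pf` in `Φ^ℝ(∗)` is GROUP-SATURATED** ([EtTh] §0: `q · b = a` with `a, b` rational forces `q`
rational — differences of rationals are rational, and `q` is effective). [cite: MochizukiEtTh2009, §0 p.8] -/
theorem isGroupSaturated_mrange_realifyPf : IsGroupSaturated (MonoidHom.mrange (realifyPf F)) := by
  rw [isGroupSaturated_iff']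
  intro q a ha b hb hqb
  obtain ⟨n₁, h₁⟩ := exists_rat_of_mem_mrange F ha
  obtain ⟨n₂, h₂⟩ := exists_rat_of_mem_mrange F hb
  refine mem_mrange_of_rat F (n₁ * n₂) fun v => ?_
  obtain ⟨k₁, hk₁⟩ := h₁ v
  obtain ⟨k₂, hk₂⟩ := h₂ v
  have hq0 : (0 : ℝ) ≤ (q.toAdd : FrakObj (ModelPlaces F) (fun _ => ℝ)).cls (.inl v) := cls_nonneg_real F q.toAdd _
  have hqcls : (q.toAdd : FrakObj (ModelPlaces F) (fun _ => ℝ)).cls (.inl v) = (k₁ : ℝ) / n₁ - (k₂ : ℝ) / n₂ := by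
    have h := congrArg (fun z : MReal F => (z.toAdd : FrakObj (ModelPlaces F) (fun _ => ℝ)).cls (.inl v)) hqb
    rw [cls_mul, hk₂] at h
    rw [← hk₁, ← h, add_sub_cancel_right]
  have hn₁ : (0 : ℝ) < (n₁ : ℕ) := by exact_mod_cast n₁.pos
  have hn₂ : (0 : ℝ) < (n₂ : ℕ) := by exact_mod_cast n₂.pos
  -- the integer `k₁ n₂ - k₂ n₁` is nonnegative
  have hint : (0 : ℤ) ≤ (k₁ : ℤ) * n₂ - (k₂ : ℤ) * n₁ := by
    have h' : (0 : ℝ) ≤ ((k₁ : ℝ) * n₂ - (k₂ : ℝ) * n₁) / ((n₁ : ℝ) * n₂) := by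
      rw [hqcls] at hq0
      have : (k₁ : ℝ) / n₁ - (k₂ : ℝ) / n₂ = ((k₁ : ℝ) * n₂ - (k₂ : ℝ) * n₁) / ((n₁ : ℝ) * n₂) := by
        field_simp
      rwa [this] at hq0
    have h'' : (0 : ℝ) ≤ (k₁ : ℝ) * n₂ - (k₂ : ℝ) * n₁ :=
      (div_nonneg_iff.mp h').elim (fun h => h.1) fun h => by
        exfalso; exact not_lt.mpr h.2 (mul_pos hn₁ hn₂)
    exact_mod_cast h''
  refine ⟨((k₁ : ℤ) * n₂ - (k₂ : ℤ) * n₁).toNat, ?_⟩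
  rw [hqcls]
  have hcast : ((((k₁ : ℤ) * n₂ - (k₂ : ℤ) * n₁).toNat : ℕ) : ℝ) = (k₁ : ℝ) * n₂ - (k₂ : ℝ) * n₁ := by
    have := Int.toNat_of_nonneg hint
    exact_mod_cast this
  rw [hcast, PNat.mul_coe]
  push_cast
  field_simp

/-- **`rlfToModel` is INJECTIVE** (order reflection of the universal extension: abc-iut-L2-d2
`RlfUniversal.lift_injective`, since `realifyPf` is injective with group-saturated image).
[cite: MochizukiEtTh2009, Lem 3.5 p.76] -/
theorem rlfToModel_injective : Function.Injective (rlfToModel F) :=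
  RlfUniversal.lift_injective (isPerfFactorial_effDiv F) (realifyPf F) (realifyPf_injective F)
    (isGroupSaturated_mrange_realifyPf F) (rlfToModel F) (rlfToModel_comp_toRealification F)

/-! ### THE identification `Φ(∗)^rlf ≅ Φ^ℝ(∗)` -/

/-- **`Φ(∗)^rlf ≅ Φ^ℝ(∗) = ⊕'_{v} ℝ_{≥0}`** ([FrdI] Thm. 6.4 (i) "`(Φ^rlf)^gp(L) = ArithDiv_ℝ(L)`" at the model of
[IUTchIII] Prop. 3.7 (ii)): THE canonical realification of the integral divisor monoid of `(†𝓕⊛_𝔪𝔬𝔡)_α` is the real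
divisor monoid of `(†𝓕⊛ℝ_𝔪𝔬𝔡)_α`, by THE homomorphism over abc-iut-w4-d005's realification on objects
(`rlfEquivModel_iotaRlf`). This is the identification J1 (SUBDAG-IUTchIII-Prop-37, categorical level) needs to compare
`Prop37.realification` with layer L1's `PreFrobenioid.realification` / `RealificationData.canonical`.
[cite: MochizukiFrdI2008, Thm. 6.4 (i) p.115] -/
def rlfEquivModel : (isPerfFactorial_effDiv F).Rlf ≃* MReal F :=
  MulEquiv.ofBijective (rlfToModel F) ⟨rlfToModel_injective F, rlfToModel_surjective F⟩

/-- `rlfEquivModel` IS `rlfToModel`. [cite: MochizukiFrdI2008, Thm. 6.4 (i) p.115] -/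
@[simp] theorem rlfEquivModel_apply (x : (isPerfFactorial_effDiv F).Rlf) : rlfEquivModel F x = rlfToModel F x := rfl

/-- **Compatibility with the realification on objects**: `rlfEquivModel (ι D) = realifyEffMul D`.
[cite: MochizukiFrdI2008, Prop. 5.3 p.103] -/
theorem rlfEquivModel_iotaRlf (D : MInt F) : rlfEquivModel F (iotaRlf F D) = realifyEffMul F D :=
  rlfToModel_iotaRlf F D

/-- … and on the perfection: `rlfEquivModel ∘ (M^pf → M^rlf) = realifyPf`. [cite: MochizukiFrdI2008, §0 p.11] -/
theorem rlfEquivModel_toRealification (x : Literature.AlgebraicGeometry.Frobenioids.Perfection (MInt F)) :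
    rlfEquivModel F ((isPerfFactorial_effDiv F).toRealification x) = realifyPf F x :=
  rlfToModel_toRealification F x

/-- The inverse on realified integral families: `rlfEquivModel⁻¹ (realifyEffMul D) = ι D`.
[cite: MochizukiFrdI2008, Prop. 5.3 p.103] -/
theorem rlfEquivModel_symm_realifyEffMul (D : MInt F) : (rlfEquivModel F).symm (realifyEffMul F D) = iotaRlf F D := by
  rw [← rlfEquivModel_iotaRlf, MulEquiv.symm_apply_apply]

end Prop37

end Literature.IUT.LogThetaLattice

end
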